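import Mathlib
import Summits.Ventures.PercRepro2.Defs
import Summits.Ventures.PercRepro2.Graph
import Summits.Ventures.PercRepro2.Events
import Summits.Ventures.PercRepro2.Harris
import Summits.Ventures.PercRepro2.DisagreementPinned
import Summits.Ventures.PercRepro2.R21PairFrame
import Summits.Ventures.PercRepro2.XWForm

/-!
# (XW) from its one-edge mixed coefficients (PercRepro2, p2 g23)

For the cross W-form `B_W = xwBil` (XWForm.lean) and an edge `g`, the **one-edge mixed
coefficient** is `M_g(p) = B_W(p[g↦0], p[g↦1]) + B_W(p[g↦1], p[g↦0])`: the two-copy form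
`E[(1 − S_XS_Y)(a_X − a_Y)(λ_X − λ_Y)]` restricted to the pairs of copies that DISAGREE at `g`
(`X` closed, `Y` open, or the reverse).  The one-edge Bernstein expansion `xxwBil_bernstein` reads
`XW(p) = (1 − t)²·XW(p[g↦0]) + t²·XW(p[g↦1]) + t(1 − t)·M_g(p)` with `t = p g`, and at a point
mass `XW = 0` (`xwBil_pinned_eq_zero`), so:

* `xw_of_mix1` — **(XW) ⟸ (XW-MIX1)**: if `0 ≤ M_g(p)` for every admissible `p` and every edge
  `g`, then `0 ≤ XW(p)` for every admissible `p` (pin induction, `pin_induction`).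

(XW-MIX1) sits strictly between (XW-BERN) (every antipodal coefficient at every point mass, which
gives every `M_F(p)`, `xw_of_xwbern`) and (XW); it is the case `C = {g}` of the dominated-pair form
(XW-DOM) of record P2-G23-XW.md §6 (`X` on `G − C`, `Y` on `G/C`).  At a point mass `M_g ≥ 0`
trivially (a single edge added to a 2-colouring); the content of (XW-MIX1) is at general `p`.
Own work; standard axioms.
-/

namespace Summit.Ventures.PercRepro2

namespace XWMix

variable {V : Type*} {E : Type*} [Fintype E] [DecidableEq E]
  {R : Type*} [CommRing R] [LinearOrder R] [IsStrictOrderedRing R]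

/-! ## Point masses (the `CDQC.prob_mul_prob_pinned` argument of mine-a g31, CDQuasiConcave.lean,
re-done over a `CommRing` so that it matches the context of `xwBil`) -/

omit [LinearOrder R] [IsStrictOrderedRing R] in
/-- Under a fully pinned weight vector the weight is the point mass at `pinnedConfig q`. -/
lemma weight_pinned_eq' [DecidableEq R] [Nontrivial R] (q : E → R) (hq : ∀ f, q f = 0 ∨ q f = 1)
    (x : Config E) : weight q x = if x = pinnedConfig q then 1 else 0 := by
  rw [weight_eq_of_pinned q ∅ (fun f _ => hq f) x, Finset.prod_empty, one_mul]
  by_cases hx : x = pinnedConfig q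
  · rw [if_pos hx, if_pos (fun e _ => by rw [hx])]
  · rw [if_neg hx, if_neg]
    intro h
    exact hx (funext fun e => h e (Finset.notMem_empty e))

omit [LinearOrder R] [IsStrictOrderedRing R] in
/-- Under a fully pinned weight vector the probability of an event is the indicator of the pinned
configuration. -/
lemma prob_pinned_eq' [DecidableEq R] [Nontrivial R] (q : E → R) (hq : ∀ f, q f = 0 ∨ q f = 1)
    (A : Set (Config E)) : prob q A = A.indicator (fun _ => (1 : R)) (pinnedConfig q) := by
  classical
  unfold prob
  have h : ∀ x : Config E, A.indicator (weight q) x =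
      if x = pinnedConfig q then A.indicator (fun _ => (1 : R)) (pinnedConfig q) else 0 := by
    intro x
    by_cases hx : x = pinnedConfig q
    · rw [if_pos hx, hx]
      by_cases hA : pinnedConfig q ∈ A
      · rw [Set.indicator_of_mem hA, Set.indicator_of_mem hA, weight_pinned_eq' q hq, if_pos rfl]
      · rw [Set.indicator_of_notMem hA, Set.indicator_of_notMem hA]
    · rw [if_neg hx]
      by_cases hA : x ∈ A
      · rw [Set.indicator_of_mem hA, weight_pinned_eq' q hq, if_neg hx]
      · rw [Set.indicator_of_notMem hA]
  simp_rw [h]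
  rw [Finset.sum_ite_eq' Finset.univ (pinnedConfig q)]
  simp only [Finset.mem_univ, if_true]

omit [LinearOrder R] [IsStrictOrderedRing R] in
/-- Under a fully pinned weight vector probabilities multiply as indicators. -/
lemma prob_mul_prob_pinned' [DecidableEq R] [Nontrivial R] (q : E → R)
    (hq : ∀ f, q f = 0 ∨ q f = 1) (A B : Set (Config E)) :
    prob q A * prob q B = prob q (A ∩ B) := by
  rw [prob_pinned_eq' q hq, prob_pinned_eq' q hq, prob_pinned_eq' q hq]
  by_cases hA : pinnedConfig q ∈ A <;> by_cases hB : pinnedConfig q ∈ B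
  · rw [Set.indicator_of_mem hA, Set.indicator_of_mem hB, Set.indicator_of_mem (Set.mem_inter hA hB),
      one_mul]
  · rw [Set.indicator_of_notMem hB,
      Set.indicator_of_notMem (fun h => hB (Set.mem_of_mem_inter_right h)), mul_zero]
  · rw [Set.indicator_of_notMem hA,
      Set.indicator_of_notMem (fun h => hA (Set.mem_of_mem_inter_left h)), zero_mul]
  · rw [Set.indicator_of_notMem hA,
      Set.indicator_of_notMem (fun h => hA (Set.mem_of_mem_inter_left h)), zero_mul]

/-- **`XW` vanishes at every point mass**: with all probabilities indicators of one configuration,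
`[aλ] + [Sa][Sλ] − [a][λ] − [S][Saλ] = [aλ] + [Saλ] − [aλ] − [Saλ] = 0`. -/
theorem xwBil_pinned_eq_zero (ends : E → Sym2 V) (s y o u : V) (q : E → R)
    (hq : ∀ f, q f = 0 ∨ q f = 1) : xwBil ends s y o u q q = 0 := by
  classical
  unfold xwBil
  rw [prob_mul_prob_pinned' q hq, prob_mul_prob_pinned' q hq, prob_mul_prob_pinned' q hq]
  have e1 : connEvent ends s y ∩ connEvent ends s u ∩ (connEvent ends s y ∩ connEvent ends y o) =
      connEvent ends s y ∩ connEvent ends s u ∩ connEvent ends y o := by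
    ext ω; simp only [Set.mem_inter_iff]; tauto
  have e2 : connEvent ends s y ∩ (connEvent ends s y ∩ connEvent ends s u ∩ connEvent ends y o) =
      connEvent ends s y ∩ connEvent ends s u ∩ connEvent ends y o := by
    ext ω; simp only [Set.mem_inter_iff]; tauto
  rw [e1, e2]
  ring

/-- **(XW) from (XW-MIX1).**  If the one-edge mixed coefficient
`M_g(p) = B_W(p[g↦0], p[g↦1]) + B_W(p[g↦1], p[g↦0])` is nonnegative for every admissible weight
vector `p` and every edge `g`, then `0 ≤ XW(p)` for every admissible `p`. -/
theorem xw_of_mix1 (ends : E → Sym2 V) (s y o u : V)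
    (hM : ∀ p : E → R, IsProbVec p → ∀ g : E,
      0 ≤ xwBil ends s y o u (Function.update p g 0) (Function.update p g 1) +
        xwBil ends s y o u (Function.update p g 1) (Function.update p g 0)) :
    ∀ p : E → R, IsProbVec p → 0 ≤ xwBil ends s y o u p p := by
  refine pin_induction (fun p : E → R => 0 ≤ xwBil ends s y o u p p) ?_ ?_
  · intro p _ hpin
    rw [xwBil_pinned_eq_zero ends s y o u p hpin]
  · intro p hp hex
    obtain ⟨g, hg0, hg1⟩ := hex
    refine ⟨g, hg0, hg1, fun h0 h1 => ?_⟩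
    rw [xxwBil_bernstein ends s y o u p p g]
    have hq0 := hp.nonneg g
    have hq1 := hp.le_one g
    have hmix := hM p hp g
    have t1 : 0 ≤ (1 - p g) * (1 - p g) * xwBil ends s y o u (Function.update p g 0)
        (Function.update p g 0) :=
      mul_nonneg (mul_nonneg (by linarith) (by linarith)) h0
    have t2 : 0 ≤ p g * p g * xwBil ends s y o u (Function.update p g 1)
        (Function.update p g 1) :=
      mul_nonneg (mul_nonneg hq0 hq0) h1
    have t3 : 0 ≤ p g * (1 - p g) *
        (xwBil ends s y o u (Function.update p g 0) (Function.update p g 1) +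
          xwBil ends s y o u (Function.update p g 1) (Function.update p g 0)) :=
      mul_nonneg (mul_nonneg hq0 (by linarith)) hmix
    nlinarith [t1, t2, t3]

end XWMix

end Summit.Ventures.PercRepro2
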